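import Summits.ValiantsHypothesis.ValiantsHypothesis.Theorems.KPlusLogSqLawTropicalBComparabilityChain

/-!
# `TropicalB` (stmt-ValiantsHypothesis-19771) — the THREE-LINK COMPARABILITY LAW, part 2: the double halving and the count
# `≤ (N + U + 1) · L₁(⌊log₂ L₁⌋+1) · L₂(⌊log₂ L₂⌋+1)`

Helper file for the crux `Theses.KPlusLogSqLaw.TropicalB` (`--supports stmt-ValiantsHypothesis-19771 --as helper`), cell
`pub-symmetroid`, seat val-sym-trop-p2 (g5).  Part 1 (`…TropicalBComparabilityChain`, imported) has the family, the exchange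
lemmas and the cross–cross count `ComparabilityChain.cc_card_le`; this file runs Gusfield's halving on the window of the second
constraint inside the halving on the window of the first and states the law.  HONEST FRAMING as in part 1: a structure theorem
about a sub-family of the terms of an arbitrary design; nothing about `TropicalB` in its window, `WeakLifting`, `MatrixDescartes`
(stmt-ValiantsHypothesis-18050) or VP ≠ VNP.

* `ComparabilityChain.cross_card_le` — members dominant at some integer slope whose FIRST interval crosses the cut `mid₁` of
  `[lo₁, hi₁)` and whose second interval lies in a window `[lo₂, lo₂ + len₂)`, `len₂ ≤ 2^k₂`, number at most
  `(N(mid₁ − lo₁) + (hi₁ − mid₁) + U) · len₂ · k₂` (halving on window 2; cross–cross members by part 1).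
* `ComparabilityChain.window_card_le` — members with first interval inside `[lo₁, lo₁ + len₁)`, `len₁ ≤ 2^k₁`, number at most
  `(N + U + 1) · len₁ · k₁ · (L₂(⌊log₂ L₂⌋+1))` (halving on window 1).
* `ComparabilityChain.card_dominant_le_three` — THE LAW: at most `(N + U + 1) · (L₁(⌊log₂ L₁⌋+1)) · (L₂(⌊log₂ L₂⌋+1))` members
  of the three-register comparability family are dominant.  Cubic in the number of register points (`≍ M³ log² M` for three-pivot
  interval registers of size `M`) against the quartic slope count; the seat's numerics (HOME/val-sym-trop-p2/g5/THREE-PIVOTS.md)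
  indicate the truth is quadratic — this bound is a rung, not believed tight.
-/

set_option linter.dupNamespace false
set_option autoImplicit false

namespace Summit.ValiantsHypothesis.ValiantsHypothesis.Theorems.KPlusLogSqLaw.ComparabilityChain

open Summit.ValiantsHypothesis.ValiantsHypothesis.Theorems.MatrixDescartes.Negative
open Finset

section Law

variable {m K N L₁ L₂ U : ℕ}
  (d : Fin K → ℕ) (v ε : Fin m → Fin m → Fin K → ℤ)
  (τ : Fin N → Fin L₁ → Fin L₁ → Fin L₂ → Fin L₂ → Fin U → Equiv.Perm (Fin m) × (Fin m → Fin K))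
  (s₁ : Fin N → Fin L₁ → ℤ) (s₂ : Fin L₁ → Fin L₂ → ℤ) (s₃ : Fin L₂ → Fin U → ℤ)
  (A : Fin N → Fin L₁ → ℤ) (W : Fin L₁ → Fin L₂ → ℤ) (B : Fin L₂ → Fin U → ℤ)
  (hinj : ∀ j y a b p u j' y' a' b' p' u', y < a → b < p → y' < a' → b' < p' →
    τ j y a b p u = τ j' y' a' b' p' u' → j = j' ∧ y = y' ∧ a = a' ∧ b = b' ∧ p = p' ∧ u = u')
  (hpres : ∀ j y a b p u, y < a → b < p → termSign ε (τ j y a b p u) ≠ 0)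
  (hw : ∀ j y a b p u (θ : ℤ), y < a → b < p →
    tropWeight d v θ (τ j y a b p u) = θ * (s₁ j y + s₂ a b + s₃ p u) - (A j y + W a b + B p u))

open scoped Classical in
include hinj hpres hw in
/-- HALVING ON WINDOW 2.  For a set `D` of members dominant at some integer slope: those whose first interval crosses the cut
`mid₁` of `[lo₁, hi₁)` (`lo₁ ≤ y < mid₁ ≤ a < hi₁`) and whose second interval `(b, p]` lies inside `[lo₂, lo₂ + len₂)` with
`len₂ ≤ 2^k₂` number at most `(N(mid₁ − lo₁) + (hi₁ − mid₁) + U) · len₂ · k₂`. -/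
theorem cross_card_le (D : Finset ((Fin N × Fin L₁ × Fin L₁ × Fin L₂ × Fin L₂ × Fin U)))
    (hD : ∀ i ∈ D, i.2.2.2.1 < i.2.2.2.2.1 ∧
      ∃ θ : ℤ, IsDominant d v ε θ (τ i.1 i.2.1 i.2.2.1 i.2.2.2.1 i.2.2.2.2.1 i.2.2.2.2.2))
    (lo₁ mid₁ hi₁ : ℕ) :
    ∀ k₂ lo₂ len₂ : ℕ, len₂ ≤ 2 ^ k₂ →
      (D.filter (fun i => lo₁ ≤ (i.2.1 : ℕ) ∧ (i.2.1 : ℕ) < mid₁ ∧ mid₁ ≤ (i.2.2.1 : ℕ) ∧ (i.2.2.1 : ℕ) < hi₁ ∧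
        lo₂ ≤ (i.2.2.2.1 : ℕ) ∧ (i.2.2.2.2.1 : ℕ) < lo₂ + len₂)).card ≤
      (N * (mid₁ - lo₁) + (hi₁ - mid₁) + U) * len₂ * k₂ := by
  set Q := N * (mid₁ - lo₁) + (hi₁ - mid₁) + U with hQ
  -- windows of length ≤ 1 contain no member (`b < p`)
  have hsmall : ∀ lo₂ len₂ : ℕ, len₂ ≤ 1 →
      D.filter (fun i => lo₁ ≤ (i.2.1 : ℕ) ∧ (i.2.1 : ℕ) < mid₁ ∧ mid₁ ≤ (i.2.2.1 : ℕ) ∧ (i.2.2.1 : ℕ) < hi₁ ∧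
        lo₂ ≤ (i.2.2.2.1 : ℕ) ∧ (i.2.2.2.2.1 : ℕ) < lo₂ + len₂) = ∅ := by
    intro lo₂ len₂ hlen
    refine Finset.filter_eq_empty_iff.2 ?_
    intro i hi h
    have hbp : (i.2.2.2.1 : ℕ) < (i.2.2.2.2.1 : ℕ) := Fin.lt_def.1 (hD i hi).1
    omega
  intro k₂
  induction k₂ with
  | zero =>
    intro lo₂ len₂ hlen
    rw [pow_zero] at hlen
    rw [hsmall lo₂ len₂ hlen]; simp
  | succ k ih =>
    intro lo₂ len₂ hlen
    rcases Nat.lt_or_ge len₂ 2 with hlt | hge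
    · rw [hsmall lo₂ len₂ (by omega)]; simp
    have hpow : 2 ^ (k + 1) = 2 * 2 ^ k := by ring
    set a₂ := len₂ / 2 with ha₂
    set b₂ := len₂ - a₂ with hb₂
    obtain ⟨hale, hble, hab⟩ : a₂ ≤ 2 ^ k ∧ b₂ ≤ 2 ^ k ∧ a₂ + b₂ = len₂ := ⟨by omega, by omega, by omega⟩
    -- three-way cover
    have hcov : D.filter (fun i => lo₁ ≤ (i.2.1 : ℕ) ∧ (i.2.1 : ℕ) < mid₁ ∧ mid₁ ≤ (i.2.2.1 : ℕ) ∧ (i.2.2.1 : ℕ) < hi₁ ∧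
          lo₂ ≤ (i.2.2.2.1 : ℕ) ∧ (i.2.2.2.2.1 : ℕ) < lo₂ + len₂) ⊆
        D.filter (fun i => lo₁ ≤ (i.2.1 : ℕ) ∧ (i.2.1 : ℕ) < mid₁ ∧ mid₁ ≤ (i.2.2.1 : ℕ) ∧ (i.2.2.1 : ℕ) < hi₁ ∧
          lo₂ ≤ (i.2.2.2.1 : ℕ) ∧ (i.2.2.2.2.1 : ℕ) < lo₂ + a₂) ∪
        (D.filter (fun i => lo₁ ≤ (i.2.1 : ℕ) ∧ (i.2.1 : ℕ) < mid₁ ∧ mid₁ ≤ (i.2.2.1 : ℕ) ∧ (i.2.2.1 : ℕ) < hi₁ ∧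
          lo₂ + a₂ ≤ (i.2.2.2.1 : ℕ) ∧ (i.2.2.2.2.1 : ℕ) < (lo₂ + a₂) + b₂) ∪
         D.filter (fun i => lo₁ ≤ (i.2.1 : ℕ) ∧ (i.2.1 : ℕ) < mid₁ ∧ mid₁ ≤ (i.2.2.1 : ℕ) ∧ (i.2.2.1 : ℕ) < hi₁ ∧
          lo₂ ≤ (i.2.2.2.1 : ℕ) ∧ (i.2.2.2.1 : ℕ) < lo₂ + a₂ ∧ lo₂ + a₂ ≤ (i.2.2.2.2.1 : ℕ) ∧
          (i.2.2.2.2.1 : ℕ) < lo₂ + len₂)) := by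
      intro i hi
      rw [Finset.mem_filter] at hi
      obtain ⟨hiD, h1, h2, h3, h4, h5, h6⟩ := hi
      simp only [Finset.mem_union, Finset.mem_filter]
      by_cases hp : (i.2.2.2.2.1 : ℕ) < lo₂ + a₂
      · exact Or.inl ⟨hiD, h1, h2, h3, h4, h5, hp⟩
      · by_cases hb : lo₂ + a₂ ≤ (i.2.2.2.1 : ℕ)
        · exact Or.inr (Or.inl ⟨hiD, h1, h2, h3, h4, hb, by omega⟩)
        · exact Or.inr (Or.inr ⟨hiD, h1, h2, h3, h4, h5, by omega, by omega, h6⟩)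
    have hcc : (D.filter (fun i => lo₁ ≤ (i.2.1 : ℕ) ∧ (i.2.1 : ℕ) < mid₁ ∧ mid₁ ≤ (i.2.2.1 : ℕ) ∧ (i.2.2.1 : ℕ) < hi₁ ∧
          lo₂ ≤ (i.2.2.2.1 : ℕ) ∧ (i.2.2.2.1 : ℕ) < lo₂ + a₂ ∧ lo₂ + a₂ ≤ (i.2.2.2.2.1 : ℕ) ∧
          (i.2.2.2.2.1 : ℕ) < lo₂ + len₂)).card ≤
        N * (mid₁ - lo₁) + (hi₁ - mid₁) * ((lo₂ + a₂) - lo₂) + U * ((lo₂ + len₂) - (lo₂ + a₂)) := by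
      refine cc_card_le d v ε τ s₁ s₂ s₃ A W B hinj hpres hw lo₁ mid₁ hi₁ lo₂ (lo₂ + a₂) (lo₂ + len₂) _ ?_
      intro i hi
      rw [Finset.mem_filter] at hi
      obtain ⟨hiD, h1, h2, h3, h4, h5, h6, h7, h8⟩ := hi
      exact ⟨h1, h2, h3, h4, h5, h6, h7, h8, (hD i hiD).2⟩
    have e1 : (lo₂ + a₂) - lo₂ = a₂ := by omega
    have e2 : (lo₂ + len₂) - (lo₂ + a₂) = b₂ := by omega
    rw [e1, e2] at hcc
    -- the cross–cross bound is at most `Q · len₂` (here `len₂ ≥ 2`)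
    have hcc' : N * (mid₁ - lo₁) + (hi₁ - mid₁) * a₂ + U * b₂ ≤ Q * len₂ := by
      have hpos : 0 < len₂ := by omega
      have h1 : N * (mid₁ - lo₁) ≤ N * (mid₁ - lo₁) * len₂ := Nat.le_mul_of_pos_right _ hpos
      have h2 : (hi₁ - mid₁) * a₂ ≤ (hi₁ - mid₁) * len₂ := Nat.mul_le_mul_left _ (by omega)
      have h3 : U * b₂ ≤ U * len₂ := Nat.mul_le_mul_left _ (by omega)
      calc N * (mid₁ - lo₁) + (hi₁ - mid₁) * a₂ + U * b₂
          ≤ N * (mid₁ - lo₁) * len₂ + (hi₁ - mid₁) * len₂ + U * len₂ := by omega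
        _ = Q * len₂ := by rw [hQ]; ring
    calc (D.filter (fun i => lo₁ ≤ (i.2.1 : ℕ) ∧ (i.2.1 : ℕ) < mid₁ ∧ mid₁ ≤ (i.2.2.1 : ℕ) ∧ (i.2.2.1 : ℕ) < hi₁ ∧
          lo₂ ≤ (i.2.2.2.1 : ℕ) ∧ (i.2.2.2.2.1 : ℕ) < lo₂ + len₂)).card
        ≤ (D.filter (fun i => lo₁ ≤ (i.2.1 : ℕ) ∧ (i.2.1 : ℕ) < mid₁ ∧ mid₁ ≤ (i.2.2.1 : ℕ) ∧ (i.2.2.1 : ℕ) < hi₁ ∧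
            lo₂ ≤ (i.2.2.2.1 : ℕ) ∧ (i.2.2.2.2.1 : ℕ) < lo₂ + a₂) ∪
          (D.filter (fun i => lo₁ ≤ (i.2.1 : ℕ) ∧ (i.2.1 : ℕ) < mid₁ ∧ mid₁ ≤ (i.2.2.1 : ℕ) ∧ (i.2.2.1 : ℕ) < hi₁ ∧
            lo₂ + a₂ ≤ (i.2.2.2.1 : ℕ) ∧ (i.2.2.2.2.1 : ℕ) < (lo₂ + a₂) + b₂) ∪
           D.filter (fun i => lo₁ ≤ (i.2.1 : ℕ) ∧ (i.2.1 : ℕ) < mid₁ ∧ mid₁ ≤ (i.2.2.1 : ℕ) ∧ (i.2.2.1 : ℕ) < hi₁ ∧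
            lo₂ ≤ (i.2.2.2.1 : ℕ) ∧ (i.2.2.2.1 : ℕ) < lo₂ + a₂ ∧ lo₂ + a₂ ≤ (i.2.2.2.2.1 : ℕ) ∧
            (i.2.2.2.2.1 : ℕ) < lo₂ + len₂))).card := Finset.card_le_card hcov
      _ ≤ (D.filter (fun i => lo₁ ≤ (i.2.1 : ℕ) ∧ (i.2.1 : ℕ) < mid₁ ∧ mid₁ ≤ (i.2.2.1 : ℕ) ∧ (i.2.2.1 : ℕ) < hi₁ ∧
            lo₂ ≤ (i.2.2.2.1 : ℕ) ∧ (i.2.2.2.2.1 : ℕ) < lo₂ + a₂)).card +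
          ((D.filter (fun i => lo₁ ≤ (i.2.1 : ℕ) ∧ (i.2.1 : ℕ) < mid₁ ∧ mid₁ ≤ (i.2.2.1 : ℕ) ∧ (i.2.2.1 : ℕ) < hi₁ ∧
            lo₂ + a₂ ≤ (i.2.2.2.1 : ℕ) ∧ (i.2.2.2.2.1 : ℕ) < (lo₂ + a₂) + b₂)).card +
           (D.filter (fun i => lo₁ ≤ (i.2.1 : ℕ) ∧ (i.2.1 : ℕ) < mid₁ ∧ mid₁ ≤ (i.2.2.1 : ℕ) ∧ (i.2.2.1 : ℕ) < hi₁ ∧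
            lo₂ ≤ (i.2.2.2.1 : ℕ) ∧ (i.2.2.2.1 : ℕ) < lo₂ + a₂ ∧ lo₂ + a₂ ≤ (i.2.2.2.2.1 : ℕ) ∧
            (i.2.2.2.2.1 : ℕ) < lo₂ + len₂)).card) :=
          le_trans (Finset.card_union_le _ _) (Nat.add_le_add_left (Finset.card_union_le _ _) _)
      _ ≤ Q * a₂ * k + (Q * b₂ * k + Q * len₂) :=
          Nat.add_le_add (ih lo₂ a₂ hale) (Nat.add_le_add (ih (lo₂ + a₂) b₂ hble) (le_trans hcc hcc'))
      _ = Q * len₂ * (k + 1) := by rw [← hab]; ring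

open scoped Classical in
include hinj hpres hw in
/-- HALVING ON WINDOW 1.  For a set `D` of members dominant at some integer slope: those whose first interval `[y, a)` lies
inside `[lo₁, lo₁ + len₁)` with `len₁ ≤ 2^k₁` number at most `(N + U + 1) · len₁ · k₁ · (L₂ · (⌊log₂ L₂⌋ + 1))`. -/
theorem window_card_le (D : Finset ((Fin N × Fin L₁ × Fin L₁ × Fin L₂ × Fin L₂ × Fin U)))
    (hD : ∀ i ∈ D, (i.2.1 < i.2.2.1 ∧ i.2.2.2.1 < i.2.2.2.2.1) ∧
      ∃ θ : ℤ, IsDominant d v ε θ (τ i.1 i.2.1 i.2.2.1 i.2.2.2.1 i.2.2.2.2.1 i.2.2.2.2.2)) :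
    ∀ k₁ lo₁ len₁ : ℕ, len₁ ≤ 2 ^ k₁ →
      (D.filter (fun i => lo₁ ≤ (i.2.1 : ℕ) ∧ (i.2.2.1 : ℕ) < lo₁ + len₁)).card ≤
      (N + U + 1) * len₁ * k₁ * (L₂ * (Nat.log 2 L₂ + 1)) := by
  set M₂ := L₂ * (Nat.log 2 L₂ + 1) with hM₂
  have hD' : ∀ i ∈ D, i.2.2.2.1 < i.2.2.2.2.1 ∧
      ∃ θ : ℤ, IsDominant d v ε θ (τ i.1 i.2.1 i.2.2.1 i.2.2.2.1 i.2.2.2.2.1 i.2.2.2.2.2) :=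
    fun i hi => ⟨(hD i hi).1.2, (hD i hi).2⟩
  have hsmall : ∀ lo₁ len₁ : ℕ, len₁ ≤ 1 →
      D.filter (fun i => lo₁ ≤ (i.2.1 : ℕ) ∧ (i.2.2.1 : ℕ) < lo₁ + len₁) = ∅ := by
    intro lo₁ len₁ hlen
    refine Finset.filter_eq_empty_iff.2 ?_
    intro i hi h
    have hya : (i.2.1 : ℕ) < (i.2.2.1 : ℕ) := Fin.lt_def.1 (hD i hi).1.1
    omega
  intro k₁
  induction k₁ with
  | zero =>
    intro lo₁ len₁ hlen
    rw [pow_zero] at hlen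
    rw [hsmall lo₁ len₁ hlen]; simp
  | succ k ih =>
    intro lo₁ len₁ hlen
    rcases Nat.lt_or_ge len₁ 2 with hlt | hge
    · rw [hsmall lo₁ len₁ (by omega)]; simp
    have hpow : 2 ^ (k + 1) = 2 * 2 ^ k := by ring
    set a₁ := len₁ / 2 with ha₁
    set b₁ := len₁ - a₁ with hb₁
    obtain ⟨hale, hble, hab⟩ : a₁ ≤ 2 ^ k ∧ b₁ ≤ 2 ^ k ∧ a₁ + b₁ = len₁ := ⟨by omega, by omega, by omega⟩
    have hcov : D.filter (fun i => lo₁ ≤ (i.2.1 : ℕ) ∧ (i.2.2.1 : ℕ) < lo₁ + len₁) ⊆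
        D.filter (fun i => lo₁ ≤ (i.2.1 : ℕ) ∧ (i.2.2.1 : ℕ) < lo₁ + a₁) ∪
        (D.filter (fun i => lo₁ + a₁ ≤ (i.2.1 : ℕ) ∧ (i.2.2.1 : ℕ) < (lo₁ + a₁) + b₁) ∪
         D.filter (fun i => lo₁ ≤ (i.2.1 : ℕ) ∧ (i.2.1 : ℕ) < lo₁ + a₁ ∧ lo₁ + a₁ ≤ (i.2.2.1 : ℕ) ∧
           (i.2.2.1 : ℕ) < lo₁ + len₁ ∧ 0 ≤ (i.2.2.2.1 : ℕ) ∧ (i.2.2.2.2.1 : ℕ) < 0 + L₂)) := by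
      intro i hi
      rw [Finset.mem_filter] at hi
      obtain ⟨hiD, h1, h2⟩ := hi
      simp only [Finset.mem_union, Finset.mem_filter]
      by_cases ha : (i.2.2.1 : ℕ) < lo₁ + a₁
      · exact Or.inl ⟨hiD, h1, ha⟩
      · by_cases hy : lo₁ + a₁ ≤ (i.2.1 : ℕ)
        · exact Or.inr (Or.inl ⟨hiD, hy, by omega⟩)
        · refine Or.inr (Or.inr ⟨hiD, h1, by omega, by omega, h2, Nat.zero_le _, ?_⟩)
          rw [Nat.zero_add]; exact i.2.2.2.2.1.isLt
    have hL₂ : L₂ ≤ 2 ^ (Nat.log 2 L₂ + 1) := (Nat.lt_pow_succ_log_self (by norm_num) L₂).le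
    have hcross := cross_card_le d v ε τ s₁ s₂ s₃ A W B hinj hpres hw D hD' lo₁ (lo₁ + a₁) (lo₁ + len₁)
      (Nat.log 2 L₂ + 1) 0 L₂ hL₂
    have e1 : (lo₁ + a₁) - lo₁ = a₁ := by omega
    have e2 : (lo₁ + len₁) - (lo₁ + a₁) = b₁ := by omega
    rw [e1, e2] at hcross
    have hcross' : (N * a₁ + b₁ + U) * L₂ * (Nat.log 2 L₂ + 1) ≤ (N + U + 1) * len₁ * M₂ := by
      have hpos : 0 < len₁ := by omega
      have h1 : N * a₁ ≤ N * len₁ := Nat.mul_le_mul_left _ (by omega)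
      have h3 : U ≤ U * len₁ := Nat.le_mul_of_pos_right _ hpos
      have h4 : N * a₁ + b₁ + U ≤ (N + U + 1) * len₁ := by
        calc N * a₁ + b₁ + U ≤ N * len₁ + len₁ + U * len₁ := by omega
          _ = (N + U + 1) * len₁ := by ring
      calc (N * a₁ + b₁ + U) * L₂ * (Nat.log 2 L₂ + 1) = (N * a₁ + b₁ + U) * M₂ := by rw [hM₂]; ring
        _ ≤ (N + U + 1) * len₁ * M₂ := Nat.mul_le_mul_right _ h4
    calc (D.filter (fun i => lo₁ ≤ (i.2.1 : ℕ) ∧ (i.2.2.1 : ℕ) < lo₁ + len₁)).card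
        ≤ (D.filter (fun i => lo₁ ≤ (i.2.1 : ℕ) ∧ (i.2.2.1 : ℕ) < lo₁ + a₁) ∪
          (D.filter (fun i => lo₁ + a₁ ≤ (i.2.1 : ℕ) ∧ (i.2.2.1 : ℕ) < (lo₁ + a₁) + b₁) ∪
           D.filter (fun i => lo₁ ≤ (i.2.1 : ℕ) ∧ (i.2.1 : ℕ) < lo₁ + a₁ ∧ lo₁ + a₁ ≤ (i.2.2.1 : ℕ) ∧
             (i.2.2.1 : ℕ) < lo₁ + len₁ ∧ 0 ≤ (i.2.2.2.1 : ℕ) ∧ (i.2.2.2.2.1 : ℕ) < 0 + L₂))).card :=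
          Finset.card_le_card hcov
      _ ≤ (D.filter (fun i => lo₁ ≤ (i.2.1 : ℕ) ∧ (i.2.2.1 : ℕ) < lo₁ + a₁)).card +
          ((D.filter (fun i => lo₁ + a₁ ≤ (i.2.1 : ℕ) ∧ (i.2.2.1 : ℕ) < (lo₁ + a₁) + b₁)).card +
           (D.filter (fun i => lo₁ ≤ (i.2.1 : ℕ) ∧ (i.2.1 : ℕ) < lo₁ + a₁ ∧ lo₁ + a₁ ≤ (i.2.2.1 : ℕ) ∧
             (i.2.2.1 : ℕ) < lo₁ + len₁ ∧ 0 ≤ (i.2.2.2.1 : ℕ) ∧ (i.2.2.2.2.1 : ℕ) < 0 + L₂)).card) :=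
          le_trans (Finset.card_union_le _ _) (Nat.add_le_add_left (Finset.card_union_le _ _) _)
      _ ≤ (N + U + 1) * a₁ * k * M₂ + ((N + U + 1) * b₁ * k * M₂ + (N + U + 1) * len₁ * M₂) :=
          Nat.add_le_add (ih lo₁ a₁ hale) (Nat.add_le_add (ih (lo₁ + a₁) b₁ hble) (le_trans hcross hcross'))
      _ = (N + U + 1) * len₁ * (k + 1) * M₂ := by rw [← hab]; ring

open scoped Classical in
include hinj hpres hw in
/-- **THE THREE-LINK COMPARABILITY LAW.**  Inside an arbitrary design `(d, v, ε)` of format `(m, K)` let `τ j y a b p u`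
(`j < N`; `y, a < L₁`; `b, p < L₂`; `u < U`) be a family of terms which, whenever `y < a` and `b < p`, are PRESENT, pairwise
distinct, and have weights `θ·(s₁ j y + s₂ a b + s₃ p u) − (A j y + W a b + B p u)` — three REGISTERS (arbitrary lines
indexed by `(j,y)`, `(a,b)`, `(p,u)`) whose slopes and valuations ADD, the middle one coupled to the outer ones ONLY through the
comparability constraints `y < a` (window of length `L₁`) and `b < p` (window of length `L₂`).  Then at most
`(N + U + 1) · L₁(⌊log₂ L₁⌋+1) · L₂(⌊log₂ L₂⌋+1)` members are dominant (each at some integer slope).  [this cell; Gusfield's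
halving on both constraint axes] -/
theorem card_dominant_le_three :
    ((Finset.univ : Finset ((Fin N × Fin L₁ × Fin L₁ × Fin L₂ × Fin L₂ × Fin U))).filter (fun i => (i.2.1 < i.2.2.1 ∧ i.2.2.2.1 < i.2.2.2.2.1) ∧
        ∃ θ : ℤ, IsDominant d v ε θ (τ i.1 i.2.1 i.2.2.1 i.2.2.2.1 i.2.2.2.2.1 i.2.2.2.2.2))).card
      ≤ (N + U + 1) * (L₁ * (Nat.log 2 L₁ + 1)) * (L₂ * (Nat.log 2 L₂ + 1)) := by
  classical
  set D := (Finset.univ : Finset ((Fin N × Fin L₁ × Fin L₁ × Fin L₂ × Fin L₂ × Fin U))).filter (fun i => (i.2.1 < i.2.2.1 ∧ i.2.2.2.1 < i.2.2.2.2.1) ∧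
        ∃ θ : ℤ, IsDominant d v ε θ (τ i.1 i.2.1 i.2.2.1 i.2.2.2.1 i.2.2.2.2.1 i.2.2.2.2.2)) with hDdef
  have hmemD : ∀ i ∈ D, (i.2.1 < i.2.2.1 ∧ i.2.2.2.1 < i.2.2.2.2.1) ∧
      ∃ θ : ℤ, IsDominant d v ε θ (τ i.1 i.2.1 i.2.2.1 i.2.2.2.1 i.2.2.2.2.1 i.2.2.2.2.2) :=
    fun i hi => (Finset.mem_filter.1 hi).2
  have hL₁ : L₁ ≤ 2 ^ (Nat.log 2 L₁ + 1) := (Nat.lt_pow_succ_log_self (by norm_num) L₁).le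
  have hall : D.filter (fun i => 0 ≤ (i.2.1 : ℕ) ∧ (i.2.2.1 : ℕ) < 0 + L₁) = D :=
    Finset.filter_true_of_mem (fun i _ => ⟨Nat.zero_le _, by rw [Nat.zero_add]; exact i.2.2.1.isLt⟩)
  have h := window_card_le d v ε τ s₁ s₂ s₃ A W B hinj hpres hw D hmemD (Nat.log 2 L₁ + 1) 0 L₁ hL₁
  rw [hall] at h
  calc D.card ≤ (N + U + 1) * L₁ * (Nat.log 2 L₁ + 1) * (L₂ * (Nat.log 2 L₂ + 1)) := h
    _ = (N + U + 1) * (L₁ * (Nat.log 2 L₁ + 1)) * (L₂ * (Nat.log 2 L₂ + 1)) := by ring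

end Law

end Summit.ValiantsHypothesis.ValiantsHypothesis.Theorems.KPlusLogSqLaw.ComparabilityChain
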